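import Literature.NumberTheory.Rogawski1990.ArchBouazizClassMultiplier     -- ★ p851490 (Σ-MULT): `exists_archSmooth₂_stOrbFamH_eq_classMul`, `bzClassH`; brings `stOrbFamH`, `bzClassMap`, `ArchSmooth₂`, `RegS`
import Literature.NumberTheory.Rogawski1990.ArchBouazizStableFamilyLinear  -- ★ p851484 (S-lin)/(Σ-ADD): `ArchSmooth₂.add/.finset_sum`, `stOrbFamH_add_of_mem_regS`, `stOrbFamH_finset_sum_of_mem_regS`, `archSmooth₂_zero`
import Literature.NumberTheory.Rogawski1990.ArchBouazizSpaceLinear         -- ★ p851483 (S-lin): `ArchBouazizSpaceH.sub`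
import Mathlib.Analysis.Calculus.BumpFunction.FiniteDimension
import HarnessLib

/-!
# THE FILTRATION ASSEMBLY OF BOUAZIZ'S SURJECTIVITY AT A WALL BASE CLASS: local surjectivity of `fH ↦ stOrbFamH νH fH` near a class `b` with CENTRAL blocks at the places `Z`,
# from four organs — (W0) chart types near `b`, (W12) «vanishing-jump germs are class multiples of the level normaliser», (W3) one generator per level chart, (Σ-MULT)/(Σ-ADD) ★
# (Bouaziz 1994 ASENS 27 §4 proof of Thm 4.1.1 ∕ §5.1 p. 588; [B1] Invent. 115 Lemma 10.1.1: «J induit une surjection du gradué associé à la filtration {D_j} sur celui de {I_j}; donc J est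
# surjective car les filtrations sont finies»)

Topic `NumberTheory/Rogawski1990`; namespace `Literature.NumberTheory.Rogawski1990`.  THEOREMS ONLY (no `def`, no instance, no notation, no axiom, no named fact, no `sorry`; the two §1 helpers are `private`): the organs
enter as HYPOTHESES at the fixed frame `(L, νH, jcH)` (their texts are registered in the W-road HOME skeleton of LH3-p01 (g6), `F0/P3c/LH3/LH3-p01/g6/wall/`, W-ROAD CENSUS v1
6129001bfae4ccc0).  Cell `pub/hodgecm-mathlib`, crux H413 (`stmt-HodgeConjecture-24833`), line LH3 (closer stub `stub_N9`, DIRECT ROAD), letter L3′, organ O-L3′-S = `BouazizSurjOfForwardStatement`,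
its (Σ-WALL) half = the `hwall` binder of ★ p851480/p851508 `bouazizSurjOfForward_of_parts ∕ _of_reg_wall` (LH10-p01 (g5)).  Author LH3-p01 (g6) ((Σ-WALL) W-road binder).  Lane
`--kind proof --supports stmt-HodgeConjecture-24833`.  Count-neutral.

THE SETTING.  `W` = complex places of the CM field `L`; a base class `b : W → ℂ × ℂ × ℂ` (per place: trace, determinant of the `U(Φ₂)_w`-block, the `U(Φ₁)_w`-entry); `Z` = the places where
`b` is CENTRAL (`tr_w² = 4 det_w`), `S₀` = the places where `b` is split-regular; the charts whose class image comes near `b` are exactly `S₀ ∪ T`, `T ⊆ Z` (organ (W0)).  The LEVEL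
NORMALISER `Q T : (W → Fin 3 → ℝ) → ℂ` is a free parameter of this file (the payer takes the compact part `∏_{w ∉ S₀ ∪ T} (1 − e^{i(c_{w,2} − c_{w,0})})` of ★ `archRH`); only its
non-vanishing on the regular sets is used.

THE ORGANS (hypotheses, quantified BEFORE the target family so that the radius is uniform in `Ψ`).
* (W0)  `hW0`  — chart types: `∃ ε₀ > 0`, every chart `S` with a regular point whose class is `ε₀`-close to `b` has `S ∖ Z = S₀`.
* (W12) `hW12` — VANISHING-JUMP GERMS ARE CLASS MULTIPLES (= (W1) zero-jump gluing ⊕ (W2) invariant smooth germ = class function, of the census): for `T ⊆ Z` and `ε > 0` there is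
  `ε′ > 0` such that every `D ∈ ArchBouazizSpaceH jcH` vanishing on the regular `ε`-tubes of the charts `S₀ ∪ insert w T`, `w ∈ Z ∖ T`, reads `D (S₀ ∪ T) c = U (bzClassMap (S₀ ∪ T) c) · Q T c`
  on the regular `ε′`-tube of `S₀ ∪ T`, for some smooth `U : (W → ℂ × ℂ × ℂ) → ℂ`.
* (W3)  `hGen` — GENERATORS: for `T ⊆ Z` a test function `g_T` whose family (G1) VANISHES on the regular `ε`-tubes of every chart `S₀ ∪ T′`, `T′ ⊆ Z`, `T′ ⊄ T`, and (G3) has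
  `stOrbFamH g_T (S₀ ∪ T) ∕ Q T → v ≠ 0` along the regular set at a point `c₀` of the `b`-fibre lying in the closure of the regular set.
* `hQ` — `Q T c ≠ 0` on `RegS (S₀ ∪ T)`; `hfwd` — the forward half (★ p851464): every `stOrbFamH νH fH` is in the space.
THE THEOREM `bzLocalSurjWall_of_parts`: `∃ ε > 0, ∀ Ψ ∈ ArchBouazizSpaceH jcH, ∃ fH ∈ C_c^∞(H_∞), stOrbFamH νH fH S c = Ψ S c` for `c ∈ RegS S`, `dist (bzClassMap S c) b < ε` — the text of `hwall`
at `b`.  PROOF = Bouaziz's finite filtration: descending induction on the level `j = |T|`; at level `j` the difference `D = Ψ − stOrbFamH fH_{j+1}` vanishes near `b` on the more split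
charts, (W12) makes `D` and the generator's family class multiples `U·Q`, `V·Q` of the same normaliser with `V(b) = v ≠ 0`, and `fH_j := fH_{j+1} + Σ_{|T| = j} ((χ_T·U_T∕V_T) ∘ bzClassH)·g_T`
((Σ-MULT) ★, (Σ-ADD) ★) repairs level `j` without touching the levels above ((G1)).  No chart at the centre, no étale section, no normal form at the `k`-fold point is used.
HONEST LABEL: L3′ stays «S-road organ-complete modulo (Σ-WALL) PRINT» until (W0), (W12) and (W3) are paid; HC_CM is proved only modulo the 7 printed citations (2 remaining: hLiu418 =
stmt-HodgeConjecture-24832, h413 = stmt-HodgeConjecture-24833) until rung 0 closes; this file is an assembly and pays nothing by itself.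

## References
* [Bouaziz1994IntegralesOrbitales] A. Bouaziz, *Intégrales orbitales sur les groupes de Lie réductifs*, Ann. Sci. ÉNS (4) 27 (1994) 573–609, §4 Thm 4.1.1 and its proof pp. 585–586
  (filtration `{I_j(U)}` by split rank, «les filtrations sont finies»), §5.1 p. 588, Thm. 6.2.1 (i) p. 592.
* [Bouaziz1994Invent115] A. Bouaziz, *Intégrales orbitales sur les algèbres de Lie réductives*, Invent. Math. 115 (1994), Thm 4.1.1, Lemma 10.1.1.
* [Shelstad1979] D. Shelstad, *Characters and inner forms of a quasi-split group over ℝ*, Compositio Math. 39 (1979), §4 Thm. 4.7 p. 31.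
-/

set_option autoImplicit false

noncomputable section

open MeasureTheory NumberField NumberField.InfinitePlace Complex Set Function Filter Topology
open Literature.NumberTheory.Automorphic Literature.NumberTheory.Automorphic.UnitaryGroup Literature.NumberTheory.Automorphic.ArchCartan
open scoped Classical ContDiff Topology

namespace Literature.NumberTheory.Rogawski1990

/-! ## §1 Two elementary facts: a positive radius below finitely many radii; a smooth cut-off quotient of class functions -/

section Prelim

/-- A positive number below a positive number attached to each member of a finite set. [folklore] -/
private theorem exists_pos_le_forall_of_finset {ι : Type*} (s : Finset ι) {δ : ι → ℝ} (hδ : ∀ i ∈ s, 0 < δ i) : ∃ ε : ℝ, 0 < ε ∧ ∀ i ∈ s, ε ≤ δ i := by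
  classical
  induction s using Finset.induction_on with
  | empty => exact ⟨1, one_pos, fun i hi => absurd hi (Finset.notMem_empty i)⟩
  | insert a s ha ih =>
    obtain ⟨ε, hε, hεs⟩ := ih fun i hi => hδ i (Finset.mem_insert_of_mem hi)
    refine ⟨min ε (δ a), lt_min hε (hδ a (Finset.mem_insert_self a s)), fun i hi => ?_⟩
    rcases Finset.mem_insert.1 hi with rfl | hi
    · exact min_le_right _ _
    · exact (min_le_left _ _).trans (hεs i hi)

variable {X : Type*} [NormedAddCommGroup X] [NormedSpace ℝ X] [FiniteDimensional ℝ X]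

/-- **Smooth cut-off quotient**: for `U`, `V` smooth with `V ≠ 0` on the ball `B(b, ρ)`, `ρ > 0`, there is a GLOBALLY smooth `F` equal to `U ∕ V` on `B(b, ρ∕2)` (a `ContDiffBump` at `b`
supported in `B(b, ρ)` times the quotient; off the bump's support the product is locally `0`). [folklore] -/
private theorem exists_contDiff_eq_div_on_ball {U V : X → ℂ} (hU : ContDiff ℝ ∞ U) (hV : ContDiff ℝ ∞ V) {b : X} {ρ : ℝ} (hρ : 0 < ρ) (hVne : ∀ y, dist y b < ρ → V y ≠ 0) :
    ∃ F : X → ℂ, ContDiff ℝ ∞ F ∧ ∀ y, dist y b < ρ / 2 → F y = U y / V y := by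
  -- the bump: `= 1` on `closedBall b (ρ/2)`, supported in `ball b (3ρ/4)`
  let χ : ContDiffBump b := ⟨ρ / 2, 3 * ρ / 4, by linarith, by linarith⟩
  refine ⟨fun y => ((χ y : ℝ) : ℂ) * (U y / V y), ?_, fun y hy => ?_⟩
  · refine contDiff_iff_contDiffAt.2 fun y => ?_
    by_cases hy : dist y b < ρ
    · -- inside the big ball: product of smooth functions (the quotient is smooth where `V ≠ 0`)
      have hO : IsOpen (Metric.ball b ρ) := Metric.isOpen_ball
      have hyO : y ∈ Metric.ball b ρ := hy
      have hq : ContDiffAt ℝ ∞ (fun y => U y / V y) y := by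
        have h1 : ContDiffAt ℝ ∞ (fun y => U y * (V y)⁻¹) y := (hU.contDiffAt).mul ((hV.contDiffAt).inv (hVne y hy))
        exact h1.congr_of_eventuallyEq (Filter.Eventually.of_forall fun z => div_eq_mul_inv (U z) (V z))
      exact ((Complex.ofRealCLM.contDiff.comp χ.contDiff).contDiffAt).mul hq
    · -- outside: the bump vanishes on a neighbourhood, so the product is locally `0`
      have hy' : ρ ≤ dist y b := le_of_not_gt hy
      have hev : (fun y => ((χ y : ℝ) : ℂ) * (U y / V y)) =ᶠ[𝓝 y] fun _ => 0 := by
        have hopen : IsOpen {z : X | 3 * ρ / 4 < dist z b} := isOpen_lt continuous_const (continuous_id.dist continuous_const)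
        have hmem : y ∈ {z : X | 3 * ρ / 4 < dist z b} := by
          show 3 * ρ / 4 < dist y b
          linarith
        filter_upwards [hopen.mem_nhds hmem] with z hz
        have hz0 : χ z = 0 := χ.zero_of_le_dist (le_of_lt hz)
        rw [hz0, Complex.ofReal_zero, zero_mul]
      exact (contDiffAt_const (c := (0 : ℂ))).congr_of_eventuallyEq hev
  · have h1 : χ y = 1 := χ.one_of_mem_closedBall (Metric.mem_closedBall.2 hy.le)
    show ((χ y : ℝ) : ℂ) * (U y / V y) = U y / V y
    rw [h1, Complex.ofReal_one, one_mul]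

end Prelim

/-! ## §2 The filtration assembly -/

section Assembly

variable (L : Type) [Field L] [NumberField L] [IsCMField L]
  [MeasurableSpace (↥(arch (↥(maximalRealSubfield L)) L (IsCMField.complexConj L) 2 (Matrix.of fun i j : Fin 2 => if i.val + j.val + 1 = 2 then (1 : L) else 0)) ×
      ↥(arch (↥(maximalRealSubfield L)) L (IsCMField.complexConj L) 1 (Matrix.of fun i j : Fin 1 => if i.val + j.val + 1 = 1 then (1 : L) else 0)))]
  [BorelSpace (↥(arch (↥(maximalRealSubfield L)) L (IsCMField.complexConj L) 2 (Matrix.of fun i j : Fin 2 => if i.val + j.val + 1 = 2 then (1 : L) else 0)) ×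
      ↥(arch (↥(maximalRealSubfield L)) L (IsCMField.complexConj L) 1 (Matrix.of fun i j : Fin 1 => if i.val + j.val + 1 = 1 then (1 : L) else 0)))]
  (νH : Measure (↥(arch (↥(maximalRealSubfield L)) L (IsCMField.complexConj L) 2 (Matrix.of fun i j : Fin 2 => if i.val + j.val + 1 = 2 then (1 : L) else 0)) ×
      ↥(arch (↥(maximalRealSubfield L)) L (IsCMField.complexConj L) 1 (Matrix.of fun i j : Fin 1 => if i.val + j.val + 1 = 1 then (1 : L) else 0))))
  [IsFiniteMeasureOnCompacts νH] [νH.IsMulRightInvariant]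

/-- **BOUAZIZ'S SURJECTIVITY AT A WALL BASE CLASS, FROM ITS ORGANS (the filtration assembly).**  See the module docstring for the organs (W0) `hW0`, (W12) `hW12`, (W3) `hGen`, the level
normaliser `Q` with `hQ`, and the forward half `hfwd`.  Conclusion = the `hwall` binder of ★ `bouazizSurjOfForward_of_parts` at the base class `b`:
`∃ ε > 0, ∀ Ψ ∈ ArchBouazizSpaceH jcH, ∃ fH, ArchSmooth₂ L fH ∧ ∀ S c, c ∈ RegS S → dist (bzClassMap S c) b < ε → stOrbFamH L νH fH S c = Ψ S c`.
Proof: descending induction on the level `j = |T|` of the charts `S₀ ∪ T`, `T ⊆ Z` — at each level the difference family vanishes near `b` on the more-split charts, so (W12) writes it, and the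
generator's family, as class multiples of the same normaliser; the quotient of the two class functions (cut off near `b`, where the generator's one does not vanish by (G3)) times the
generator repairs the level ((Σ-MULT) ★ `exists_archSmooth₂_stOrbFamH_eq_classMul`, (Σ-ADD) ★ `stOrbFamH_add/finset_sum_of_mem_regS`), and (G1) keeps the higher levels and the other
charts of the level intact; the radius shrinks finitely often and never depends on `Ψ`. [cite: Bouaziz1994IntegralesOrbitales, §4 proof of Thm 4.1.1 pp. 585–586; §5.1 p. 588; Thm. 6.2.1 (i) p. 592]
[cite: Shelstad1979, Thm. 4.7 (p. 31)] -/
theorem bzLocalSurjWall_of_parts (jcH : Finset {w : InfinitePlace L // IsComplex w} → {w : InfinitePlace L // IsComplex w} → ℂ)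
    (hfwd : ∀ fH : ↥(arch (↥(maximalRealSubfield L)) L (IsCMField.complexConj L) 2 (Matrix.of fun i j : Fin 2 => if i.val + j.val + 1 = 2 then (1 : L) else 0)) ×
      ↥(arch (↥(maximalRealSubfield L)) L (IsCMField.complexConj L) 1 (Matrix.of fun i j : Fin 1 => if i.val + j.val + 1 = 1 then (1 : L) else 0)) → ℂ,
      ArchSmooth₂ L fH → ArchBouazizSpaceH jcH (stOrbFamH L νH fH))
    (b : {w : InfinitePlace L // IsComplex w} → ℂ × ℂ × ℂ) (Z S₀ : Finset {w : InfinitePlace L // IsComplex w})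
    (Q : Finset {w : InfinitePlace L // IsComplex w} → ({w : InfinitePlace L // IsComplex w} → Fin 3 → ℝ) → ℂ)
    -- (W0) chart types near `b`
    (hW0 : ∃ ε₀ : ℝ, 0 < ε₀ ∧ ∀ (S : Finset {w : InfinitePlace L // IsComplex w}) (c : {w : InfinitePlace L // IsComplex w} → Fin 3 → ℝ),
      c ∈ RegS S → dist (bzClassMap S c) b < ε₀ → S \ Z = S₀)
    -- the level normaliser does not vanish on the regular sets
    (hQ : ∀ T, T ⊆ Z → ∀ c, c ∈ RegS (S₀ ∪ T) → Q T c ≠ 0)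
    -- (W12) vanishing-jump germs are class multiples of the level normaliser (radius uniform in the family)
    (hW12 : ∀ T, T ⊆ Z → ∀ ε : ℝ, 0 < ε → ∃ ε' : ℝ, 0 < ε' ∧
      ∀ D : Finset {w : InfinitePlace L // IsComplex w} → ({w : InfinitePlace L // IsComplex w} → Fin 3 → ℝ) → ℂ, ArchBouazizSpaceH jcH D →
        (∀ w ∈ Z, w ∉ T → ∀ c, c ∈ RegS (S₀ ∪ insert w T) → dist (bzClassMap (S₀ ∪ insert w T) c) b < ε → D (S₀ ∪ insert w T) c = 0) →
        ∃ U : ({w : InfinitePlace L // IsComplex w} → ℂ × ℂ × ℂ) → ℂ, ContDiff ℝ ∞ U ∧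
          ∀ c, c ∈ RegS (S₀ ∪ T) → dist (bzClassMap (S₀ ∪ T) c) b < ε' → D (S₀ ∪ T) c = U (bzClassMap (S₀ ∪ T) c) * Q T c)
    -- (W3) one generator per level chart: (G1) vanishing on the other charts not below it, (G3) non-zero normalised limit at a fibre point
    (hGen : ∀ T, T ⊆ Z → ∃ g : ↥(arch (↥(maximalRealSubfield L)) L (IsCMField.complexConj L) 2 (Matrix.of fun i j : Fin 2 => if i.val + j.val + 1 = 2 then (1 : L) else 0)) ×
      ↥(arch (↥(maximalRealSubfield L)) L (IsCMField.complexConj L) 1 (Matrix.of fun i j : Fin 1 => if i.val + j.val + 1 = 1 then (1 : L) else 0)) → ℂ,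
      ArchSmooth₂ L g ∧
        (∃ ε : ℝ, 0 < ε ∧ ∀ T', T' ⊆ Z → ¬ T' ⊆ T → ∀ c, c ∈ RegS (S₀ ∪ T') → dist (bzClassMap (S₀ ∪ T') c) b < ε → stOrbFamH L νH g (S₀ ∪ T') c = 0) ∧
        ∃ (c₀ : {w : InfinitePlace L // IsComplex w} → Fin 3 → ℝ) (v : ℂ), bzClassMap (S₀ ∪ T) c₀ = b ∧ c₀ ∈ closure (RegS (S₀ ∪ T)) ∧ v ≠ 0 ∧
          Tendsto (fun c => stOrbFamH L νH g (S₀ ∪ T) c / Q T c) (𝓝[RegS (S₀ ∪ T)] c₀) (𝓝 v)) :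
    ∃ ε : ℝ, 0 < ε ∧ ∀ Ψ : Finset {w : InfinitePlace L // IsComplex w} → ({w : InfinitePlace L // IsComplex w} → Fin 3 → ℝ) → ℂ, ArchBouazizSpaceH jcH Ψ →
      ∃ fH : ↥(arch (↥(maximalRealSubfield L)) L (IsCMField.complexConj L) 2 (Matrix.of fun i j : Fin 2 => if i.val + j.val + 1 = 2 then (1 : L) else 0)) ×
        ↥(arch (↥(maximalRealSubfield L)) L (IsCMField.complexConj L) 1 (Matrix.of fun i j : Fin 1 => if i.val + j.val + 1 = 1 then (1 : L) else 0)) → ℂ,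
        ArchSmooth₂ L fH ∧ ∀ (S : Finset {w : InfinitePlace L // IsComplex w}) (c : {w : InfinitePlace L // IsComplex w} → Fin 3 → ℝ),
          c ∈ RegS S → dist (bzClassMap S c) b < ε → stOrbFamH L νH fH S c = Ψ S c := by
  -- the invariant of the descending induction: levels `≥ j` are repaired on a radius uniform in `Ψ`
  have key : ∀ j : ℕ, ∃ ε : ℝ, 0 < ε ∧ ∀ Ψ : Finset {w : InfinitePlace L // IsComplex w} → ({w : InfinitePlace L // IsComplex w} → Fin 3 → ℝ) → ℂ, ArchBouazizSpaceH jcH Ψ →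
      ∃ fH, ArchSmooth₂ L fH ∧ ∀ T, T ⊆ Z → j ≤ T.card → ∀ c, c ∈ RegS (S₀ ∪ T) → dist (bzClassMap (S₀ ∪ T) c) b < ε →
        stOrbFamH L νH fH (S₀ ∪ T) c = Ψ (S₀ ∪ T) c := by
    -- monotonicity in `j`
    have mono : ∀ j j' : ℕ, j ≤ j' → (∃ ε : ℝ, 0 < ε ∧ ∀ Ψ : Finset {w : InfinitePlace L // IsComplex w} → ({w : InfinitePlace L // IsComplex w} → Fin 3 → ℝ) → ℂ, ArchBouazizSpaceH jcH Ψ →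
        ∃ fH, ArchSmooth₂ L fH ∧ ∀ T, T ⊆ Z → j ≤ T.card → ∀ c, c ∈ RegS (S₀ ∪ T) → dist (bzClassMap (S₀ ∪ T) c) b < ε →
          stOrbFamH L νH fH (S₀ ∪ T) c = Ψ (S₀ ∪ T) c) →
        (∃ ε : ℝ, 0 < ε ∧ ∀ Ψ : Finset {w : InfinitePlace L // IsComplex w} → ({w : InfinitePlace L // IsComplex w} → Fin 3 → ℝ) → ℂ, ArchBouazizSpaceH jcH Ψ →
        ∃ fH, ArchSmooth₂ L fH ∧ ∀ T, T ⊆ Z → j' ≤ T.card → ∀ c, c ∈ RegS (S₀ ∪ T) → dist (bzClassMap (S₀ ∪ T) c) b < ε →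
          stOrbFamH L νH fH (S₀ ∪ T) c = Ψ (S₀ ∪ T) c) := by
      rintro j j' hjj' ⟨ε, hε, h⟩
      refine ⟨ε, hε, fun Ψ hΨ => ?_⟩
      obtain ⟨fH, hfH, hagree⟩ := h Ψ hΨ
      exact ⟨fH, hfH, fun T hT hj' c hc hd => hagree T hT (hjj'.trans hj') c hc hd⟩
    -- the top: no chart has more than `|Z|` split central places
    have top : ∃ ε : ℝ, 0 < ε ∧ ∀ Ψ : Finset {w : InfinitePlace L // IsComplex w} → ({w : InfinitePlace L // IsComplex w} → Fin 3 → ℝ) → ℂ, ArchBouazizSpaceH jcH Ψ →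
        ∃ fH, ArchSmooth₂ L fH ∧ ∀ T, T ⊆ Z → Z.card + 1 ≤ T.card → ∀ c, c ∈ RegS (S₀ ∪ T) → dist (bzClassMap (S₀ ∪ T) c) b < ε →
          stOrbFamH L νH fH (S₀ ∪ T) c = Ψ (S₀ ∪ T) c := by
      refine ⟨1, one_pos, fun Ψ _ => ⟨0, archSmooth₂_zero L, fun T hT hcard c _ _ => ?_⟩⟩
      exact absurd ((Finset.card_le_card hT).trans_lt (Nat.lt_succ_self _)) (not_lt.2 hcard)
    -- THE STEP: from level `j + 1` to level `j`
    have step : ∀ j : ℕ, (∃ ε : ℝ, 0 < ε ∧ ∀ Ψ : Finset {w : InfinitePlace L // IsComplex w} → ({w : InfinitePlace L // IsComplex w} → Fin 3 → ℝ) → ℂ, ArchBouazizSpaceH jcH Ψ →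
        ∃ fH, ArchSmooth₂ L fH ∧ ∀ T, T ⊆ Z → j + 1 ≤ T.card → ∀ c, c ∈ RegS (S₀ ∪ T) → dist (bzClassMap (S₀ ∪ T) c) b < ε →
          stOrbFamH L νH fH (S₀ ∪ T) c = Ψ (S₀ ∪ T) c) →
        (∃ ε : ℝ, 0 < ε ∧ ∀ Ψ : Finset {w : InfinitePlace L // IsComplex w} → ({w : InfinitePlace L // IsComplex w} → Fin 3 → ℝ) → ℂ, ArchBouazizSpaceH jcH Ψ →
        ∃ fH, ArchSmooth₂ L fH ∧ ∀ T, T ⊆ Z → j ≤ T.card → ∀ c, c ∈ RegS (S₀ ∪ T) → dist (bzClassMap (S₀ ∪ T) c) b < ε →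
          stOrbFamH L νH fH (S₀ ∪ T) c = Ψ (S₀ ∪ T) c) := by
      rintro j ⟨ε₁, hε₁, hup⟩
      -- the level: `𝒯 = {T ⊆ Z : |T| = j}`
      set 𝒯 : Finset (Finset {w : InfinitePlace L // IsComplex w}) := Z.powerset.filter fun T => T.card = j with h𝒯def
      have h𝒯 : ∀ T ∈ 𝒯, T ⊆ Z ∧ T.card = j := fun T hT => by
        simpa only [h𝒯def, Finset.mem_filter, Finset.mem_powerset] using hT
      -- (a) per level chart: the class-multiple radius for differences vanishing on the `ε₁`-tubes above
      choose! εU hεU hU using fun T (hT : T ∈ 𝒯) => hW12 T (h𝒯 T hT).1 ε₁ hε₁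
      -- (b) per level chart: the generator, its vanishing radius, its fibre point and limit
      choose! g hg hG1ex hrest using fun T (hT : T ∈ 𝒯) => hGen T (h𝒯 T hT).1
      choose! εg hεg hG1 using hG1ex
      choose! c₀ v hc₀b hc₀cl hv hlim using hrest
      -- (c) per level chart: the generator's family is a class multiple `V · Q` near `b` (by (W12) at radius `εg`), with `V b = v ≠ 0`
      choose! εV hεV hVex using fun T (hT : T ∈ 𝒯) => hW12 T (h𝒯 T hT).1 (εg T) (hεg T hT)
      have hgen_space : ∀ T ∈ 𝒯, ArchBouazizSpaceH jcH (stOrbFamH L νH (g T)) := fun T hT => hfwd _ (hg T hT)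
      have hgen_van : ∀ T ∈ 𝒯, ∀ w ∈ Z, w ∉ T → ∀ c, c ∈ RegS (S₀ ∪ insert w T) → dist (bzClassMap (S₀ ∪ insert w T) c) b < εg T →
          stOrbFamH L νH (g T) (S₀ ∪ insert w T) c = 0 := by
        intro T hT w hw hwT c hc hd
        refine hG1 T hT (insert w T) (Finset.insert_subset hw (h𝒯 T hT).1) (fun h => hwT (h (Finset.mem_insert_self w T))) c hc hd
      choose! V hV hVeq using fun T (hT : T ∈ 𝒯) => hVex T hT (stOrbFamH L νH (g T)) (hgen_space T hT) (hgen_van T hT)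
      -- `V T b = v T ≠ 0`: the normalised family tends to `v` along the regular set and equals `V ∘ cl` there, which is continuous at `c₀` with value `V b`
      have hVb : ∀ T ∈ 𝒯, V T b = v T := by
        intro T hT
        haveI : (𝓝[RegS (S₀ ∪ T)] (c₀ T)).NeBot := mem_closure_iff_nhdsWithin_neBot.1 (hc₀cl T hT)
        -- `V ∘ bzClassMap` tends to `V b` along the regular set
        have hcont : Tendsto (fun c => V T (bzClassMap (S₀ ∪ T) c)) (𝓝[RegS (S₀ ∪ T)] (c₀ T)) (𝓝 (V T b)) := by
          have h1 : ContinuousAt (fun c => V T (bzClassMap (S₀ ∪ T) c)) (c₀ T) :=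
            ((hV T hT).continuous.comp (continuous_bzClassMap (S₀ ∪ T))).continuousAt
          have h2 := h1.tendsto
          rw [hc₀b T hT] at h2
          exact h2.mono_left nhdsWithin_le_nhds
        -- eventually along the regular set the two functions agree
        have hev : (fun c => stOrbFamH L νH (g T) (S₀ ∪ T) c / Q T c) =ᶠ[𝓝[RegS (S₀ ∪ T)] (c₀ T)] fun c => V T (bzClassMap (S₀ ∪ T) c) := by
          have hball : ∀ᶠ c in 𝓝 (c₀ T), dist (bzClassMap (S₀ ∪ T) c) b < εV T := by
            have hc : ContinuousAt (fun c => dist (bzClassMap (S₀ ∪ T) c) b) (c₀ T) :=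
              ((continuous_bzClassMap (S₀ ∪ T)).dist continuous_const).continuousAt
            have h0 : dist (bzClassMap (S₀ ∪ T) (c₀ T)) b < εV T := by rw [hc₀b T hT, dist_self]; exact hεV T hT
            exact hc.eventually (gt_mem_nhds h0)
          filter_upwards [nhdsWithin_le_nhds hball, self_mem_nhdsWithin] with c hcd hc
          rw [hVeq T hT c hc hcd, mul_div_assoc, div_self (hQ T (h𝒯 T hT).1 c hc), mul_one]
        exact tendsto_nhds_unique (hcont.congr' hev.symm) (hlim T hT)
      -- a radius `ρ_T` on which `V T ≠ 0`
      have hρex : ∀ T ∈ 𝒯, ∃ ρ : ℝ, 0 < ρ ∧ ∀ y, dist y b < ρ → V T y ≠ 0 := by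
        intro T hT
        have hc : ContinuousAt (V T) b := (hV T hT).continuous.continuousAt
        have hne : V T b ≠ 0 := by rw [hVb T hT]; exact hv T hT
        have hev : ∀ᶠ y in 𝓝 b, V T y ≠ 0 := hc.eventually_ne hne
        obtain ⟨ρ, hρ, hball⟩ := Metric.eventually_nhds_iff.1 hev
        exact ⟨ρ, hρ, fun y hy => hball hy⟩
      choose! ρ hρ hVne using hρex
      -- the new radius: below `ε₁` and, for every level chart, below `εU`, `εg`, `εV`, `ρ/2`
      obtain ⟨δ, hδ, hδle⟩ := exists_pos_le_forall_of_finset 𝒯 (δ := fun T => min (min (εU T) (εg T)) (min (εV T) (ρ T / 2)))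
        fun T hT => lt_min (lt_min (hεU T hT) (hεg T hT)) (lt_min (hεV T hT) (half_pos (hρ T hT)))
      have hδU : ∀ T ∈ 𝒯, δ ≤ εU T := fun T hT => (hδle T hT).trans ((min_le_left _ _).trans (min_le_left _ _))
      have hδg : ∀ T ∈ 𝒯, δ ≤ εg T := fun T hT => (hδle T hT).trans ((min_le_left _ _).trans (min_le_right _ _))
      have hδV : ∀ T ∈ 𝒯, δ ≤ εV T := fun T hT => (hδle T hT).trans ((min_le_right _ _).trans (min_le_left _ _))
      have hδρ : ∀ T ∈ 𝒯, δ ≤ ρ T / 2 := fun T hT => (hδle T hT).trans ((min_le_right _ _).trans (min_le_right _ _))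
      refine ⟨min ε₁ δ, lt_min hε₁ hδ, fun Ψ hΨ => ?_⟩
      -- the repair of level `j` for the family `Ψ`
      obtain ⟨fH₁, hfH₁, hagree₁⟩ := hup Ψ hΨ
      -- the difference family and its vanishing on the `ε₁`-tubes of the charts above the level
      obtain ⟨D, hDdef⟩ : ∃ D : Finset {w : InfinitePlace L // IsComplex w} → ({w : InfinitePlace L // IsComplex w} → Fin 3 → ℝ) → ℂ,
          D = fun S c => Ψ S c - stOrbFamH L νH fH₁ S c := ⟨_, rfl⟩
      have hD : ArchBouazizSpaceH jcH D := by
        rw [hDdef]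
        exact hΨ.sub (hfwd fH₁ hfH₁)
      have hDvan : ∀ T ∈ 𝒯, ∀ w ∈ Z, w ∉ T → ∀ c, c ∈ RegS (S₀ ∪ insert w T) → dist (bzClassMap (S₀ ∪ insert w T) c) b < ε₁ → D (S₀ ∪ insert w T) c = 0 := by
        intro T hT w hw hwT c hc hd
        have hsub : insert w T ⊆ Z := Finset.insert_subset hw (h𝒯 T hT).1
        have hcard : j + 1 ≤ (insert w T).card := by rw [Finset.card_insert_of_notMem hwT, (h𝒯 T hT).2]
        rw [hDdef]
        simp only [hagree₁ (insert w T) hsub hcard c hc hd, sub_self]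
      choose! U hUs hUeq using fun T (hT : T ∈ 𝒯) => hU T hT D hD (hDvan T hT)
      -- the cut-off quotients `F T = U T / V T` on `B(b, ρ_T/2)`
      choose! F hF hFeq using fun T (hT : T ∈ 𝒯) => exists_contDiff_eq_div_on_ball (hUs T hT) (hV T hT) (hρ T hT) (hVne T hT)
      -- the correctors `h T = (F T ∘ bzClassH) · g T` ((Σ-MULT) ★)
      choose! h hh hheq using fun T (hT : T ∈ 𝒯) => exists_archSmooth₂_stOrbFamH_eq_classMul L νH (F T) (hF T hT) (g T) (hg T hT)
      -- the new test function
      refine ⟨fH₁ + ∑ T ∈ 𝒯, h T, hfH₁.add (ArchSmooth₂.finset_sum 𝒯 fun T hT => hh T hT), fun T' hT' hjT' c hc hd => ?_⟩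
      have hd₁ : dist (bzClassMap (S₀ ∪ T') c) b < ε₁ := hd.trans_le (min_le_left _ _)
      have hdδ : dist (bzClassMap (S₀ ∪ T') c) b < δ := hd.trans_le (min_le_right _ _)
      -- additivity of the family on the regular set
      have hsumsm : ArchSmooth₂ L (∑ T ∈ 𝒯, h T) := ArchSmooth₂.finset_sum 𝒯 fun T hT => hh T hT
      rw [stOrbFamH_add_of_mem_regS L νH (S₀ ∪ T') hfH₁.continuous hfH₁.hasCompactSupport hsumsm.continuous hsumsm.hasCompactSupport hc,
        stOrbFamH_finset_sum_of_mem_regS L νH (S₀ ∪ T') 𝒯 (fun T hT => (hh T hT).continuous) (fun T hT => (hh T hT).hasCompactSupport) hc]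
      -- each corrector reads `F T (cl c) · stOrbFamH (g T)`
      have hcorr : ∀ T ∈ 𝒯, stOrbFamH L νH (h T) (S₀ ∪ T') c = F T (bzClassMap (S₀ ∪ T') c) * stOrbFamH L νH (g T) (S₀ ∪ T') c := fun T hT => hheq T hT (S₀ ∪ T') c hc
      rw [Finset.sum_congr rfl hcorr]
      rcases Nat.lt_or_ge j T'.card with hlt | hge
      · -- a chart ABOVE the level: already repaired, and every corrector vanishes there ((G1): `T' ⊄ T` by cardinality)
        have hup' : stOrbFamH L νH fH₁ (S₀ ∪ T') c = Ψ (S₀ ∪ T') c := hagree₁ T' hT' hlt c hc hd₁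
        have hzero : ∀ T ∈ 𝒯, F T (bzClassMap (S₀ ∪ T') c) * stOrbFamH L νH (g T) (S₀ ∪ T') c = 0 := by
          intro T hT
          have hnot : ¬ T' ⊆ T := fun hsub => by
            have := Finset.card_le_card hsub
            rw [(h𝒯 T hT).2] at this
            exact absurd hlt (not_lt.2 this)
          rw [hG1 T hT T' hT' hnot c hc (hdδ.trans_le (hδg T hT)), mul_zero]
        rw [Finset.sum_eq_zero hzero, add_zero, hup']
      · -- a chart OF the level: `T' ∈ 𝒯`; its own corrector repairs it, the others vanish
        have hT'card : T'.card = j := le_antisymm hge hjT'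
        have hT'mem : T' ∈ 𝒯 := by
          simp only [h𝒯def, Finset.mem_filter, Finset.mem_powerset]
          exact ⟨hT', hT'card⟩
        rw [← Finset.add_sum_erase 𝒯 _ hT'mem]
        have hothers : ∀ T ∈ 𝒯.erase T', F T (bzClassMap (S₀ ∪ T') c) * stOrbFamH L νH (g T) (S₀ ∪ T') c = 0 := by
          intro T hT
          have hTne : T ≠ T' := Finset.ne_of_mem_erase hT
          have hT𝒯 : T ∈ 𝒯 := Finset.mem_of_mem_erase hT
          have hnot : ¬ T' ⊆ T := fun hsub => hTne (Finset.eq_of_subset_of_card_le hsub (by rw [(h𝒯 T hT𝒯).2, hT'card])).symm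
          rw [hG1 T hT𝒯 T' hT' hnot c hc (hdδ.trans_le (hδg T hT𝒯)), mul_zero]
        rw [Finset.sum_eq_zero hothers, add_zero]
        -- the own corrector: `F (cl c) · V (cl c) · Q c = U (cl c) · Q c = D c`
        have hdρ : dist (bzClassMap (S₀ ∪ T') c) b < ρ T' / 2 := hdδ.trans_le (hδρ T' hT'mem)
        have hdV : dist (bzClassMap (S₀ ∪ T') c) b < εV T' := hdδ.trans_le (hδV T' hT'mem)
        have hdU : dist (bzClassMap (S₀ ∪ T') c) b < εU T' := hdδ.trans_le (hδU T' hT'mem)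
        have hVne' : V T' (bzClassMap (S₀ ∪ T') c) ≠ 0 := hVne T' hT'mem _ (hdρ.trans (half_lt_self (hρ T' hT'mem)))
        rw [hFeq T' hT'mem _ hdρ, hVeq T' hT'mem c hc hdV, ← mul_assoc, div_mul_cancel₀ _ hVne', ← hUeq T' hT'mem c hc hdU, hDdef]
        ring
    -- the induction proper: `∀ m, Inv (|Z| + 1 − m)`
    have hind : ∀ m : ℕ, ∃ ε : ℝ, 0 < ε ∧ ∀ Ψ : Finset {w : InfinitePlace L // IsComplex w} → ({w : InfinitePlace L // IsComplex w} → Fin 3 → ℝ) → ℂ, ArchBouazizSpaceH jcH Ψ →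
        ∃ fH, ArchSmooth₂ L fH ∧ ∀ T, T ⊆ Z → Z.card + 1 - m ≤ T.card → ∀ c, c ∈ RegS (S₀ ∪ T) → dist (bzClassMap (S₀ ∪ T) c) b < ε →
          stOrbFamH L νH fH (S₀ ∪ T) c = Ψ (S₀ ∪ T) c := by
      intro m
      induction m with
      | zero => simpa only [Nat.sub_zero] using top
      | succ m ih => exact step _ (mono _ _ (by omega) ih)
    intro j
    exact mono _ _ (by omega) (hind (Z.card + 1))
  -- conclusion: every chart near `b` is `S₀ ∪ (S ∩ Z)` by (W0)
  obtain ⟨ε₀, hε₀, htype⟩ := hW0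
  obtain ⟨ε₁, hε₁, hall⟩ := key 0
  refine ⟨min ε₀ ε₁, lt_min hε₀ hε₁, fun Ψ hΨ => ?_⟩
  obtain ⟨fH, hfH, hagree⟩ := hall Ψ hΨ
  refine ⟨fH, hfH, fun S c hc hd => ?_⟩
  have hSZ : S \ Z = S₀ := htype S c hc (hd.trans_le (min_le_left _ _))
  have hS : S = S₀ ∪ (S ∩ Z) := by rw [← hSZ, Finset.sdiff_union_inter]
  have hT : S ∩ Z ⊆ Z := Finset.inter_subset_right
  have key' := hagree (S ∩ Z) hT (Nat.zero_le _)
  rw [← hS] at key'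
  exact key' c hc (hd.trans_le (min_le_right _ _))

end Assembly

end Literature.NumberTheory.Rogawski1990

end
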